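import Mathlib
import HarnessLib
import Summits.QuantumFields.YangMills.Theses.GronwallGap
import Summits.QuantumFields.YangMills.Theorems.GronwallGapPathGapModulusStubSumRuleLipschitz

/-!
# `PathGapModulus` (stmt-QuantumFields-13946) — continuity-method infrastructure of line `registered` (skeleton `Lines/birth.lean`)

Helpers for the crux `Summit.QuantumFields.YangMills.Theses.GronwallGap.PathGapModulus` (route `GronwallGap`),
kernel-checking the structural findings of the line leads (cycle 1: lead 0; cycle 2: lead c1):

* `pathGapModulus_iff_noGapCollapse` — under the rev-4 rate cap `min m M` the crux's log-Lipschitz modulus carries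
  no quantitative content: the crux is EQUIVALENT to the qualitative statement NoGapCollapse "along an admissible
  analytic-pressure weight path, if one parameter's theory clusters volume-uniformly at some rate then every
  parameter's theory does at one common rate `μ > 0`" (`K := 0`, cap `M := μ` always work; the clustering predicate
  is antitone in the rate, `pathGap_clusterBound_antitone`).
* `pathGap_uniformFloor_of_localFloor_of_closed` — the abstract real-analysis composition of the reshaped skeleton:
  for a predicate `P s m` ("rate `m` is available at parameter `s`") antitone in the rate, a LOCAL FLOOR (every
  parameter carrying a rate has a neighbourhood in `[0,1]` carrying one common rate) and CLOSEDNESS (a parameter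
  approximated by parameters carrying rates carries a rate) turn one parameter carrying a rate into a UNIFORM rate
  on `[0,1]` — connectedness of `[0,1]` (the set of parameters carrying a rate is clopen and non-empty) plus
  sequential compactness (no sequence of parameters can lose every rate).
* `pathGapModulus_of_localFloor_of_closed` — hence the crux follows from the two registered stubs of the skeleton,
  `stub_localFloor` (the uniformly-clustering parameter set is relatively open in `[0,1]` with a locally uniform
  rate: the perturbative half) and `stub_closedUnderAnalyticPressure` (it is relatively closed: the non-perturbative
  half, where the analytic-pressure certificate must bite), whose statements appear verbatim as the two hypotheses.
* `pathGap_localFloor_of_pathGapModulus`, `pathGap_closed_of_pathGapModulus` — conversely the crux implies each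
  stub statement (the reshape is safe: a refutation of either stub refutes the crux).
-/

namespace Summit.QuantumFields.YangMills.Theorems

open Filter Set Topology

/-- **The rate cap makes the modulus vacuous: `PathGapModulus ↔ NoGapCollapse`.** The right-hand side is the
crux's verbatim preamble followed by: one volume-uniformly clustering parameter on an admissible analytic-pressure
path forces a common clustering rate `μ > 0` at every parameter of `[0,1]`. (→): one application of the modulus
from the clustering parameter `s₀` (distance `≤ 1`, so the rate `min m₀ M · e^(−|K|) / 2` is always allowed).
(←): `K := 0` and cap `M := μ`; every rate the capped modulus asks for is `< min m μ ≤ μ`, which every parameter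
already has since the clustering bound is antitone in the rate; if no parameter clusters the crux is vacuous.
[folklore] -/
theorem pathGapModulus_iff_noGapCollapse :
    Summit.QuantumFields.YangMills.Theses.GronwallGap.PathGapModulus ↔
    (∀ (G : Type) [Group G] [TopologicalSpace G] [IsTopologicalGroup G] [CompactSpace G],
      Literature.MathematicalPhysics.QuantumFieldTheory.IsCompactSimpleLieGroup G →
      letI : MeasurableSpace G := borel G; haveI : BorelSpace G := ⟨rfl⟩;
      let UCw : (ℝ → G → ℝ) → ℝ → ℝ → Prop := fun w s m => ∀ A B : Literature.MathematicalPhysics.QuantumFieldTheory.YMSpecies G, ∃ C : ℝ, ∃ S₀ : ℕ, ∀ S : ℕ, S₀ ≤ S → ∀ n : ℕ, n ≤ S → |(∫ U, A.F (Literature.MathematicalPhysics.QuantumLattice.torusLift (2 * S + 1) U) * B.F (Literature.MathematicalPhysics.QuantumLattice.configShift (-Pi.single 0 (n : ℤ)) (Literature.MathematicalPhysics.QuantumLattice.torusLift (2 * S + 1) U)) ∂(Literature.MathematicalPhysics.QuantumLattice.groupHeatKernelMeasure (d := 4) (L := 2 * S + 1) w s)) - (∫ U, A.F (Literature.MathematicalPhysics.QuantumLattice.torusLift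 (2 * S + 1) U) ∂(Literature.MathematicalPhysics.QuantumLattice.groupHeatKernelMeasure (d := 4) (L := 2 * S + 1) w s)) * (∫ U, B.F (Literature.MathematicalPhysics.QuantumLattice.torusLift (2 * S + 1) U) ∂(Literature.MathematicalPhysics.QuantumLattice.groupHeatKernelMeasure (d := 4) (L := 2 * S + 1) w s))| ≤ C * Real.exp (-(m * n));
      let Pseq : (G → ℝ) → ℕ → ℝ := fun v L => (((L + 1 : ℕ) : ℝ) ^ 4)⁻¹ * Real.log (((MeasureTheory.Measure.pi fun _ : Literature.MathematicalPhysics.QuantumFieldTheory.Edge 4 (L + 1) => Literature.MathematicalPhysics.QuantumFieldTheory.haarProbability G).withDensity (fun U : Literature.MathematicalPhysics.QuantumFieldTheory.GaugeConfig 4 (L + 1) G => ENNReal.ofReal (Literature.MathematicalPhysics.QuantumLattice.groupHeatKernelWeight (fun _ : ℝ => v) 0 U))) Set.univ).toReal;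
      let AnP : (G → ℝ) → Prop := fun v => ∀ φ : G → ℝ, Continuous φ → (∀ g h : G, φ (h * g * h⁻¹) = φ g) → ∃ p : ℝ → ℝ, (∀ t : ℝ, Filter.Tendsto (fun L : ℕ => Pseq (fun g => v g * Real.exp (t * φ g)) L) Filter.atTop (nhds (p t))) ∧ AnalyticAt ℝ p 0;
      let Adm : (ℝ → G → ℝ) → Prop := fun w => (∀ s ∈ Set.Icc (0 : ℝ) 1, Continuous (w s) ∧ (∀ g : G, 0 < w s g) ∧ (∀ g h : G, w s (h * g * h⁻¹) = w s g) ∧ (∀ g : G, w s g⁻¹ = w s g) ∧ (∀ (n : ℕ) (x : Fin n → G) (c : Fin n → ℂ), 0 ≤ (∑ i, ∑ j, (starRingEnd ℂ) (c i) * c j * ((w s ((x i)⁻¹ * x j) : ℝ) : ℂ)).re)) ∧ ∃ Λ : ℝ, ∀ s ∈ Set.Icc (0 : ℝ) 1, ∀ s' ∈ Set.Icc (0 : ℝ) 1, ∀ g : G, |Real.log (w s g) - Real.log (w s' g)| ≤ Λ * |s - s'|;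
      ∀ w : ℝ → G → ℝ, Adm w → (∀ s ∈ Set.Icc (0 : ℝ) 1, AnP (w s)) →
        (∃ s₀ ∈ Set.Icc (0 : ℝ) 1, ∃ m₀ : ℝ, 0 < m₀ ∧ UCw w s₀ m₀) → ∃ μ : ℝ, 0 < μ ∧ ∀ s ∈ Set.Icc (0 : ℝ) 1, UCw w s μ) := by
  constructor
  · intro hPG G _ _ _ _ hG UCw Pseq AnP Adm w hAdm hAn hex
    obtain ⟨s₀, hs₀, m₀, hm₀, hU₀⟩ := hex
    have hmono : ∀ s m m', 0 < m' → m' ≤ m → UCw w s m → UCw w s m' :=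
      fun s m m' _ hle hU A B => pathGap_clusterBound_antitone hle (hU A B)
    obtain ⟨K, M, hM, hK⟩ := hPG G hG w hAdm hAn
    have hmM : 0 < min m₀ M := lt_min hm₀ hM
    refine ⟨min m₀ M * Real.exp (-|K|) / 2, by positivity, fun s hs => ?_⟩
    refine hK s₀ hs₀ s hs m₀ hm₀ hU₀ _ (by positivity) ?_
    have hd : |s - s₀| ≤ 1 := by
      rw [abs_le]; constructor <;> linarith [hs.1, hs.2, hs₀.1, hs₀.2]
    have hexp : Real.exp (-|K|) ≤ Real.exp (-(K * |s - s₀|)) := by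
      rw [Real.exp_le_exp]
      have h1 : K * |s - s₀| ≤ |K| * |s - s₀| :=
        mul_le_mul_of_nonneg_right (le_abs_self K) (abs_nonneg _)
      have h2 : |K| * |s - s₀| ≤ |K| := by
        calc |K| * |s - s₀| ≤ |K| * 1 := mul_le_mul_of_nonneg_left hd (abs_nonneg K)
          _ = |K| := mul_one _
      linarith
    have hpos : 0 < min m₀ M * Real.exp (-|K|) := by positivity
    calc min m₀ M * Real.exp (-|K|) / 2 < min m₀ M * Real.exp (-|K|) := half_lt_self hpos
      _ ≤ min m₀ M * Real.exp (-(K * |s - s₀|)) := mul_le_mul_of_nonneg_left hexp hmM.le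
  · intro hNGC G _ _ _ _ hG UCw Pseq AnP Adm w hAdm hAn
    have hmono : ∀ s m m', 0 < m' → m' ≤ m → UCw w s m → UCw w s m' :=
      fun s m m' _ hle hU A B => pathGap_clusterBound_antitone hle (hU A B)
    by_cases hex : ∃ s₀ ∈ Set.Icc (0 : ℝ) 1, ∃ m₀ : ℝ, 0 < m₀ ∧ UCw w s₀ m₀
    · obtain ⟨μ, hμ, hall⟩ := hNGC G hG w hAdm hAn hex
      refine ⟨0, μ, hμ, ?_⟩
      intro s hs s' hs' m hm _ m' hm' hlt
      have hle : m' ≤ μ := by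
        have h1 : min m μ * Real.exp (-(0 * |s' - s|)) = min m μ := by simp
        rw [h1] at hlt
        exact hlt.le.trans (min_le_right _ _)
      exact hmono s' μ m' hm' hle (hall s' hs')
    · refine ⟨0, 1, one_pos, ?_⟩
      intro s hs s' hs' m hm hP m' hm' hlt
      exact (hex ⟨s, hs, m, hm, hP⟩).elim

/-- **Continuity method on `[0,1]`, abstract form.** Let `P s m` ("rate `m` is available at parameter `s`") be
antitone in the rate. If (i) every point of `[0,1]` carrying a rate has a neighbourhood in `[0,1]` carrying one
common rate (local floor ⇒ the set `Γ` of parameters carrying a rate is relatively open), and (ii) every point of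
`[0,1]` approximated by points carrying rates carries a rate (`Γ` relatively closed), then ONE point carrying a rate
forces a UNIFORM rate `μ > 0` on all of `[0,1]`: `Γ` is a non-empty clopen subset of the connected space `[0,1]`,
hence everything, and by sequential compactness no sequence of parameters can lose every rate. [folklore] -/
theorem pathGap_uniformFloor_of_localFloor_of_closed {P : ℝ → ℝ → Prop}
    (hmono : ∀ s m m', 0 < m' → m' ≤ m → P s m → P s m')
    (hopen : ∀ s₀ ∈ Icc (0 : ℝ) 1, ∀ m₀ : ℝ, 0 < m₀ → P s₀ m₀ →
      ∃ ε μ : ℝ, 0 < ε ∧ 0 < μ ∧ ∀ s ∈ Icc (0 : ℝ) 1, |s - s₀| < ε → P s μ)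
    (hclosed : ∀ s₀ ∈ Icc (0 : ℝ) 1,
      (∀ ε : ℝ, 0 < ε → ∃ s ∈ Icc (0 : ℝ) 1, |s - s₀| < ε ∧ ∃ m : ℝ, 0 < m ∧ P s m) →
        ∃ m₀ : ℝ, 0 < m₀ ∧ P s₀ m₀) :
    (∃ s₀ ∈ Icc (0 : ℝ) 1, ∃ m₀ : ℝ, 0 < m₀ ∧ P s₀ m₀) →
      ∃ μ : ℝ, 0 < μ ∧ ∀ s ∈ Icc (0 : ℝ) 1, P s μ := by
  rintro ⟨s₀, hs₀, m₀, hm₀, hP₀⟩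
  -- the set of parameters carrying some rate
  set Γ : Set ℝ := {s | s ∈ Icc (0 : ℝ) 1 ∧ ∃ m : ℝ, 0 < m ∧ P s m} with hΓ
  have hΓsub : Γ ⊆ Icc (0 : ℝ) 1 := fun s hs => hs.1
  have hs₀Γ : s₀ ∈ Γ := ⟨hs₀, m₀, hm₀, hP₀⟩
  -- (ii) ⇒ `Γ` is closed in `ℝ`
  have hΓclosed : IsClosed Γ := by
    refine closure_subset_iff_isClosed.mp fun x hx => ?_
    have hxI : x ∈ Icc (0 : ℝ) 1 := by
      have h := closure_mono hΓsub hx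
      rwa [isClosed_Icc.closure_eq] at h
    refine ⟨hxI, hclosed x hxI fun ε hε => ?_⟩
    obtain ⟨b, hb, hdist⟩ := Metric.mem_closure_iff.mp hx ε hε
    refine ⟨b, hb.1, ?_, hb.2⟩
    rwa [Real.dist_eq, abs_sub_comm] at hdist
  -- (i) ⇒ every point of `[0,1]` close to `Γ` lies in `Γ`
  have hnbhd : ∀ s ∈ Γ, ∃ ε : ℝ, 0 < ε ∧ ∀ s' ∈ Icc (0 : ℝ) 1, |s' - s| < ε → s' ∈ Γ := by
    rintro s ⟨hs, m, hm, hP⟩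
    obtain ⟨ε, μ, hε, hμ, h⟩ := hopen s hs m hm hP
    exact ⟨ε, hε, fun s' hs' hd => ⟨hs', μ, hμ, h s' hs' hd⟩⟩
  choose! εf hεf hεΓ using hnbhd
  set U : Set ℝ := ⋃ s ∈ Γ, Metric.ball s (εf s) with hU
  have hUopen : IsOpen U := isOpen_biUnion fun s _ => Metric.isOpen_ball
  have hΓU : Γ ⊆ U := fun s hs => Set.mem_biUnion hs (Metric.mem_ball_self (hεf s hs))
  have hIU : ∀ x ∈ Icc (0 : ℝ) 1, x ∈ U → x ∈ Γ := by
    intro x hx hxU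
    rw [hU, Set.mem_iUnion₂] at hxU
    obtain ⟨s, hs, hxs⟩ := hxU
    rw [Metric.mem_ball, Real.dist_eq] at hxs
    exact hεΓ s hs x hx hxs
  -- `[0,1]` is connected ⇒ `Γ = [0,1]`
  have hall : ∀ x ∈ Icc (0 : ℝ) 1, x ∈ Γ := by
    by_contra hcon
    push Not at hcon
    obtain ⟨x, hx, hxΓ⟩ := hcon
    have hcover : Icc (0 : ℝ) 1 ⊆ U ∪ Γᶜ := fun y _ => by
      by_cases hyΓ : y ∈ Γ
      · exact Or.inl (hΓU hyΓ)
      · exact Or.inr hyΓ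
    obtain ⟨y, hyI, hyU, hyΓc⟩ := isPreconnected_Icc U Γᶜ hUopen hΓclosed.isOpen_compl hcover
      ⟨s₀, hs₀, hΓU hs₀Γ⟩ ⟨x, hx, hxΓ⟩
    exact hyΓc (hIU y hyI hyU)
  -- `[0,1]` is sequentially compact ⇒ the rate is uniform
  by_contra hneg
  push Not at hneg
  have hseq : ∀ k : ℕ, ∃ s ∈ Icc (0 : ℝ) 1, ¬ P s (1 / ((k : ℝ) + 1)) := fun k => hneg _ (by positivity)
  choose x hxI hxP using hseq
  obtain ⟨a, haI, φ, hφ, hlim⟩ := isCompact_Icc.tendsto_subseq hxI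
  obtain ⟨_, m, hm, hPa⟩ := hall a haI
  obtain ⟨ε, μ, hε, hμ, hloc⟩ := hopen a haI m hm hPa
  have hev1 : ∀ᶠ k in atTop, |x (φ k) - a| < ε := by
    obtain ⟨N, hN⟩ := Metric.tendsto_atTop.mp hlim ε hε
    exact Filter.eventually_atTop.mpr ⟨N, fun n hn => by simpa [Real.dist_eq] using hN n hn⟩
  have hev2 : ∀ᶠ k in atTop, 1 / ((φ k : ℝ) + 1) ≤ μ := by
    obtain ⟨N, hN⟩ := exists_nat_gt (1 / μ)
    refine Filter.eventually_atTop.mpr ⟨N, fun k hk => ?_⟩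
    have hφk : (k : ℝ) ≤ φ k := by exact_mod_cast hφ.id_le k
    have hNk : (N : ℝ) ≤ k := by exact_mod_cast hk
    have hpos : (0 : ℝ) < (φ k : ℝ) + 1 := by positivity
    rw [div_le_iff₀ hpos]
    have h1 : 1 / μ < (φ k : ℝ) + 1 := by linarith
    have h2 : 1 < ((φ k : ℝ) + 1) * μ := by
      have := (div_lt_iff₀ hμ).mp h1
      linarith
    linarith
  obtain ⟨k, hk1, hk2⟩ := (hev1.and hev2).exists
  exact hxP (φ k) (hmono _ _ _ (by positivity) hk2 (hloc _ (hxI (φ k)) hk1))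

/-- **The crux from the two halves of the continuity method** (the composition of the reshaped skeleton
`Cruxes/PathGapModulus/Lines/birth.lean`, lead c1, cycle 2): the statements of the registered stubs `stub_localFloor`
(first hypothesis, verbatim) and `stub_closedUnderAnalyticPressure` (second hypothesis, verbatim) imply
`PathGapModulus` — via NoGapCollapse (`pathGap_uniformFloor_of_localFloor_of_closed` with `P := UCw w`) and
`pathGapModulus_iff_noGapCollapse`. [folklore] -/
theorem pathGapModulus_of_localFloor_of_closed :
    (∀ (G : Type) [Group G] [TopologicalSpace G] [IsTopologicalGroup G] [CompactSpace G],
      Literature.MathematicalPhysics.QuantumFieldTheory.IsCompactSimpleLieGroup G →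
      letI : MeasurableSpace G := borel G; haveI : BorelSpace G := ⟨rfl⟩;
      let UCw : (ℝ → G → ℝ) → ℝ → ℝ → Prop := fun w s m => ∀ A B : Literature.MathematicalPhysics.QuantumFieldTheory.YMSpecies G, ∃ C : ℝ, ∃ S₀ : ℕ, ∀ S : ℕ, S₀ ≤ S → ∀ n : ℕ, n ≤ S → |(∫ U, A.F (Literature.MathematicalPhysics.QuantumLattice.torusLift (2 * S + 1) U) * B.F (Literature.MathematicalPhysics.QuantumLattice.configShift (-Pi.single 0 (n : ℤ)) (Literature.MathematicalPhysics.QuantumLattice.torusLift (2 * S + 1) U)) ∂(Literature.MathematicalPhysics.QuantumLattice.groupHeatKernelMeasure (d := 4) (L := 2 * S + 1) w s)) - (∫ U, A.F (Literature.MathematicalPhysics.QuantumLattice.torusLift (2 * S + 1) U) ∂(Literature.MathematicalPhysics.QuantumLattice.groupHeatKernelMeasure (d := 4) (L := 2 * S + 1) w s)) * (∫ U, B.F (Literature.MathematicalPhysics.QuantumLattice.torusLift (2 * S + 1) U) ∂(Literature.MathematicalPhysics.QuantumLattice.groupHeatKernelMeasure (d := 4) (L := 2 * S + 1) w s))| ≤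 C * Real.exp (-(m * n));
      let Pseq : (G → ℝ) → ℕ → ℝ := fun v L => (((L + 1 : ℕ) : ℝ) ^ 4)⁻¹ * Real.log (((MeasureTheory.Measure.pi fun _ : Literature.MathematicalPhysics.QuantumFieldTheory.Edge 4 (L + 1) => Literature.MathematicalPhysics.QuantumFieldTheory.haarProbability G).withDensity (fun U : Literature.MathematicalPhysics.QuantumFieldTheory.GaugeConfig 4 (L + 1) G => ENNReal.ofReal (Literature.MathematicalPhysics.QuantumLattice.groupHeatKernelWeight (fun _ : ℝ => v) 0 U))) Set.univ).toReal;
      let AnP : (G → ℝ) → Prop := fun v => ∀ φ : G → ℝ, Continuous φ → (∀ g h : G, φ (h * g * h⁻¹) = φ g) → ∃ p : ℝ → ℝ, (∀ t : ℝ, Filter.Tendsto (fun L : ℕ => Pseq (fun g => v g * Real.exp (t * φ g)) L) Filter.atTop (nhds (p t))) ∧ AnalyticAt ℝ p 0;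
      let Adm : (ℝ → G → ℝ) → Prop := fun w => (∀ s ∈ Set.Icc (0 : ℝ) 1, Continuous (w s) ∧ (∀ g : G, 0 < w s g) ∧ (∀ g h : G, w s (h * g * h⁻¹) = w s g) ∧ (∀ g : G, w s g⁻¹ = w s g) ∧ (∀ (n : ℕ) (x : Fin n → G) (c : Fin n → ℂ), 0 ≤ (∑ i, ∑ j, (starRingEnd ℂ) (c i) * c j * ((w s ((x i)⁻¹ * x j) : ℝ) : ℂ)).re)) ∧ ∃ Λ : ℝ, ∀ s ∈ Set.Icc (0 : ℝ) 1, ∀ s' ∈ Set.Icc (0 : ℝ) 1, ∀ g : G, |Real.log (w s g) - Real.log (w s' g)| ≤ Λ * |s - s'|;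
      ∀ w : ℝ → G → ℝ, Adm w → (∀ s ∈ Set.Icc (0 : ℝ) 1, AnP (w s)) →
        ∀ s₀ ∈ Set.Icc (0 : ℝ) 1, ∀ m₀ : ℝ, 0 < m₀ → UCw w s₀ m₀ → ∃ ε μ : ℝ, 0 < ε ∧ 0 < μ ∧ ∀ s ∈ Set.Icc (0 : ℝ) 1, |s - s₀| < ε → UCw w s μ) →
    (∀ (G : Type) [Group G] [TopologicalSpace G] [IsTopologicalGroup G] [CompactSpace G],
      Literature.MathematicalPhysics.QuantumFieldTheory.IsCompactSimpleLieGroup G →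
      letI : MeasurableSpace G := borel G; haveI : BorelSpace G := ⟨rfl⟩;
      let UCw : (ℝ → G → ℝ) → ℝ → ℝ → Prop := fun w s m => ∀ A B : Literature.MathematicalPhysics.QuantumFieldTheory.YMSpecies G, ∃ C : ℝ, ∃ S₀ : ℕ, ∀ S : ℕ, S₀ ≤ S → ∀ n : ℕ, n ≤ S → |(∫ U, A.F (Literature.MathematicalPhysics.QuantumLattice.torusLift (2 * S + 1) U) * B.F (Literature.MathematicalPhysics.QuantumLattice.configShift (-Pi.single 0 (n : ℤ)) (Literature.MathematicalPhysics.QuantumLattice.torusLift (2 * S + 1) U)) ∂(Literature.MathematicalPhysics.QuantumLattice.groupHeatKernelMeasure (d := 4) (L := 2 * S + 1) w s)) - (∫ U, A.F (Literature.MathematicalPhysics.QuantumLattice.torusLift (2 * S + 1) U) ∂(Literature.MathematicalPhysics.QuantumLattice.groupHeatKernelMeasure (d := 4) (L := 2 * S + 1) w s)) * (∫ U, B.F (Literature.MathematicalPhysics.QuantumLattice.torusLift (2 * S + 1) U) ∂(Literature.MathematicalPhysics.QuantumLattice.groupHeatKernelMeasure (d := 4) (L := 2 * S + 1) w s))| ≤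 C * Real.exp (-(m * n));
      let Pseq : (G → ℝ) → ℕ → ℝ := fun v L => (((L + 1 : ℕ) : ℝ) ^ 4)⁻¹ * Real.log (((MeasureTheory.Measure.pi fun _ : Literature.MathematicalPhysics.QuantumFieldTheory.Edge 4 (L + 1) => Literature.MathematicalPhysics.QuantumFieldTheory.haarProbability G).withDensity (fun U : Literature.MathematicalPhysics.QuantumFieldTheory.GaugeConfig 4 (L + 1) G => ENNReal.ofReal (Literature.MathematicalPhysics.QuantumLattice.groupHeatKernelWeight (fun _ : ℝ => v) 0 U))) Set.univ).toReal;
      let AnP : (G → ℝ) → Prop := fun v => ∀ φ : G → ℝ, Continuous φ → (∀ g h : G, φ (h * g * h⁻¹) = φ g) → ∃ p : ℝ → ℝ, (∀ t : ℝ, Filter.Tendsto (fun L : ℕ => Pseq (fun g => v g * Real.exp (t * φ g)) L) Filter.atTop (nhds (p t))) ∧ AnalyticAt ℝ p 0;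
      let Adm : (ℝ → G → ℝ) → Prop := fun w => (∀ s ∈ Set.Icc (0 : ℝ) 1, Continuous (w s) ∧ (∀ g : G, 0 < w s g) ∧ (∀ g h : G, w s (h * g * h⁻¹) = w s g) ∧ (∀ g : G, w s g⁻¹ = w s g) ∧ (∀ (n : ℕ) (x : Fin n → G) (c : Fin n → ℂ), 0 ≤ (∑ i, ∑ j, (starRingEnd ℂ) (c i) * c j * ((w s ((x i)⁻¹ * x j) : ℝ) : ℂ)).re)) ∧ ∃ Λ : ℝ, ∀ s ∈ Set.Icc (0 : ℝ) 1, ∀ s' ∈ Set.Icc (0 : ℝ) 1, ∀ g : G, |Real.log (w s g) - Real.log (w s' g)| ≤ Λ * |s - s'|;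
      ∀ w : ℝ → G → ℝ, Adm w → (∀ s ∈ Set.Icc (0 : ℝ) 1, AnP (w s)) →
        ∀ s₀ ∈ Set.Icc (0 : ℝ) 1, (∀ ε : ℝ, 0 < ε → ∃ s ∈ Set.Icc (0 : ℝ) 1, |s - s₀| < ε ∧ ∃ m : ℝ, 0 < m ∧ UCw w s m) → ∃ m₀ : ℝ, 0 < m₀ ∧ UCw w s₀ m₀) →
    Summit.QuantumFields.YangMills.Theses.GronwallGap.PathGapModulus := by
  intro h₁ h₂
  refine pathGapModulus_iff_noGapCollapse.mpr ?_
  intro G _ _ _ _ hG UCw Pseq AnP Adm w hAdm hAn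
  have hmono : ∀ s m m', 0 < m' → m' ≤ m → UCw w s m → UCw w s m' :=
    fun s m m' _ hle hU A B => pathGap_clusterBound_antitone hle (hU A B)
  exact pathGap_uniformFloor_of_localFloor_of_closed hmono (h₁ G hG w hAdm hAn) (h₂ G hG w hAdm hAn)

/-- **The reshape is safe, half 1**: the crux implies the statement of `stub_localFloor` (pure logic through
NoGapCollapse: the common rate `μ` serves every parameter, so any `ε > 0` works). Hence a refutation of that stub
refutes the crux itself. [folklore] -/
theorem pathGap_localFloor_of_pathGapModulus
    (h : Summit.QuantumFields.YangMills.Theses.GronwallGap.PathGapModulus) :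
    ∀ (G : Type) [Group G] [TopologicalSpace G] [IsTopologicalGroup G] [CompactSpace G],
      Literature.MathematicalPhysics.QuantumFieldTheory.IsCompactSimpleLieGroup G →
      letI : MeasurableSpace G := borel G; haveI : BorelSpace G := ⟨rfl⟩;
      let UCw : (ℝ → G → ℝ) → ℝ → ℝ → Prop := fun w s m => ∀ A B : Literature.MathematicalPhysics.QuantumFieldTheory.YMSpecies G, ∃ C : ℝ, ∃ S₀ : ℕ, ∀ S : ℕ, S₀ ≤ S → ∀ n : ℕ, n ≤ S → |(∫ U, A.F (Literature.MathematicalPhysics.QuantumLattice.torusLift (2 * S + 1) U) * B.F (Literature.MathematicalPhysics.QuantumLattice.configShift (-Pi.single 0 (n : ℤ)) (Literature.MathematicalPhysics.QuantumLattice.torusLift (2 * S + 1) U)) ∂(Literature.MathematicalPhysics.QuantumLattice.groupHeatKernelMeasure (d := 4) (L := 2 * S + 1) w s)) - (∫ U, A.F (Literature.MathematicalPhysics.QuantumLattice.torusLift (2 * S + 1) U) ∂(Literature.MathematicalPhysics.QuantumLattice.groupHeatKernelMeasure (d := 4) (L := 2 * S + 1) w s)) * (∫ U, B.F (Literature.MathematicalPhysics.QuantumLattice.torusLift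 (2 * S + 1) U) ∂(Literature.MathematicalPhysics.QuantumLattice.groupHeatKernelMeasure (d := 4) (L := 2 * S + 1) w s))| ≤ C * Real.exp (-(m * n));
      let Pseq : (G → ℝ) → ℕ → ℝ := fun v L => (((L + 1 : ℕ) : ℝ) ^ 4)⁻¹ * Real.log (((MeasureTheory.Measure.pi fun _ : Literature.MathematicalPhysics.QuantumFieldTheory.Edge 4 (L + 1) => Literature.MathematicalPhysics.QuantumFieldTheory.haarProbability G).withDensity (fun U : Literature.MathematicalPhysics.QuantumFieldTheory.GaugeConfig 4 (L + 1) G => ENNReal.ofReal (Literature.MathematicalPhysics.QuantumLattice.groupHeatKernelWeight (fun _ : ℝ => v) 0 U))) Set.univ).toReal;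
      let AnP : (G → ℝ) → Prop := fun v => ∀ φ : G → ℝ, Continuous φ → (∀ g h : G, φ (h * g * h⁻¹) = φ g) → ∃ p : ℝ → ℝ, (∀ t : ℝ, Filter.Tendsto (fun L : ℕ => Pseq (fun g => v g * Real.exp (t * φ g)) L) Filter.atTop (nhds (p t))) ∧ AnalyticAt ℝ p 0;
      let Adm : (ℝ → G → ℝ) → Prop := fun w => (∀ s ∈ Set.Icc (0 : ℝ) 1, Continuous (w s) ∧ (∀ g : G, 0 < w s g) ∧ (∀ g h : G, w s (h * g * h⁻¹) = w s g) ∧ (∀ g : G, w s g⁻¹ = w s g) ∧ (∀ (n : ℕ) (x : Fin n → G) (c : Fin n → ℂ), 0 ≤ (∑ i, ∑ j, (starRingEnd ℂ) (c i) * c j * ((w s ((x i)⁻¹ * x j) : ℝ) : ℂ)).re)) ∧ ∃ Λ : ℝ, ∀ s ∈ Set.Icc (0 : ℝ) 1, ∀ s' ∈ Set.Icc (0 : ℝ) 1, ∀ g : G, |Real.log (w s g) - Real.log (w s' g)| ≤ Λ * |s - s'|;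
      ∀ w : ℝ → G → ℝ, Adm w → (∀ s ∈ Set.Icc (0 : ℝ) 1, AnP (w s)) →
        ∀ s₀ ∈ Set.Icc (0 : ℝ) 1, ∀ m₀ : ℝ, 0 < m₀ → UCw w s₀ m₀ → ∃ ε μ : ℝ, 0 < ε ∧ 0 < μ ∧ ∀ s ∈ Set.Icc (0 : ℝ) 1, |s - s₀| < ε → UCw w s μ := by
  intro G _ _ _ _ hG UCw Pseq AnP Adm w hAdm hAn s₀ hs₀ m₀ hm₀ hU₀
  obtain ⟨μ, hμ, hall⟩ := pathGapModulus_iff_noGapCollapse.mp h G hG w hAdm hAn ⟨s₀, hs₀, m₀, hm₀, hU₀⟩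
  exact ⟨1, μ, one_pos, hμ, fun s hs _ => hall s hs⟩

/-- **The reshape is safe, half 2**: the crux implies the statement of `stub_closedUnderAnalyticPressure` (pure
logic through NoGapCollapse: one approximating clustering parameter already forces a common rate everywhere).
Hence a refutation of that stub refutes the crux itself. [folklore] -/
theorem pathGap_closed_of_pathGapModulus
    (h : Summit.QuantumFields.YangMills.Theses.GronwallGap.PathGapModulus) :
    ∀ (G : Type) [Group G] [TopologicalSpace G] [IsTopologicalGroup G] [CompactSpace G],
      Literature.MathematicalPhysics.QuantumFieldTheory.IsCompactSimpleLieGroup G →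
      letI : MeasurableSpace G := borel G; haveI : BorelSpace G := ⟨rfl⟩;
      let UCw : (ℝ → G → ℝ) → ℝ → ℝ → Prop := fun w s m => ∀ A B : Literature.MathematicalPhysics.QuantumFieldTheory.YMSpecies G, ∃ C : ℝ, ∃ S₀ : ℕ, ∀ S : ℕ, S₀ ≤ S → ∀ n : ℕ, n ≤ S → |(∫ U, A.F (Literature.MathematicalPhysics.QuantumLattice.torusLift (2 * S + 1) U) * B.F (Literature.MathematicalPhysics.QuantumLattice.configShift (-Pi.single 0 (n : ℤ)) (Literature.MathematicalPhysics.QuantumLattice.torusLift (2 * S + 1) U)) ∂(Literature.MathematicalPhysics.QuantumLattice.groupHeatKernelMeasure (d := 4) (L := 2 * S + 1) w s)) - (∫ U, A.F (Literature.MathematicalPhysics.QuantumLattice.torusLift (2 * S + 1) U) ∂(Literature.MathematicalPhysics.QuantumLattice.groupHeatKernelMeasure (d := 4) (L := 2 * S + 1) w s)) * (∫ U, B.F (Literature.MathematicalPhysics.QuantumLattice.torusLift (2 * S + 1) U) ∂(Literature.MathematicalPhysics.QuantumLattice.groupHeatKernelMeasure (d := 4) (L := 2 * S + 1) w s))| ≤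 C * Real.exp (-(m * n));
      let Pseq : (G → ℝ) → ℕ → ℝ := fun v L => (((L + 1 : ℕ) : ℝ) ^ 4)⁻¹ * Real.log (((MeasureTheory.Measure.pi fun _ : Literature.MathematicalPhysics.QuantumFieldTheory.Edge 4 (L + 1) => Literature.MathematicalPhysics.QuantumFieldTheory.haarProbability G).withDensity (fun U : Literature.MathematicalPhysics.QuantumFieldTheory.GaugeConfig 4 (L + 1) G => ENNReal.ofReal (Literature.MathematicalPhysics.QuantumLattice.groupHeatKernelWeight (fun _ : ℝ => v) 0 U))) Set.univ).toReal;
      let AnP : (G → ℝ) → Prop := fun v => ∀ φ : G → ℝ, Continuous φ → (∀ g h : G, φ (h * g * h⁻¹) = φ g) → ∃ p : ℝ → ℝ, (∀ t : ℝ, Filter.Tendsto (fun L : ℕ => Pseq (fun g => v g * Real.exp (t * φ g)) L) Filter.atTop (nhds (p t))) ∧ AnalyticAt ℝ p 0;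
      let Adm : (ℝ → G → ℝ) → Prop := fun w => (∀ s ∈ Set.Icc (0 : ℝ) 1, Continuous (w s) ∧ (∀ g : G, 0 < w s g) ∧ (∀ g h : G, w s (h * g * h⁻¹) = w s g) ∧ (∀ g : G, w s g⁻¹ = w s g) ∧ (∀ (n : ℕ) (x : Fin n → G) (c : Fin n → ℂ), 0 ≤ (∑ i, ∑ j, (starRingEnd ℂ) (c i) * c j * ((w s ((x i)⁻¹ * x j) : ℝ) : ℂ)).re)) ∧ ∃ Λ : ℝ, ∀ s ∈ Set.Icc (0 : ℝ) 1, ∀ s' ∈ Set.Icc (0 : ℝ) 1, ∀ g : G, |Real.log (w s g) - Real.log (w s' g)| ≤ Λ * |s - s'|;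
      ∀ w : ℝ → G → ℝ, Adm w → (∀ s ∈ Set.Icc (0 : ℝ) 1, AnP (w s)) →
        ∀ s₀ ∈ Set.Icc (0 : ℝ) 1, (∀ ε : ℝ, 0 < ε → ∃ s ∈ Set.Icc (0 : ℝ) 1, |s - s₀| < ε ∧ ∃ m : ℝ, 0 < m ∧ UCw w s m) → ∃ m₀ : ℝ, 0 < m₀ ∧ UCw w s₀ m₀ := by
  intro G _ _ _ _ hG UCw Pseq AnP Adm w hAdm hAn s₀ hs₀ happrox
  obtain ⟨s, hs, _, m, hm, hU⟩ := happrox 1 one_pos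
  obtain ⟨μ, hμ, hall⟩ := pathGapModulus_iff_noGapCollapse.mp h G hG w hAdm hAn ⟨s, hs, m, hm, hU⟩
  exact ⟨μ, hμ, hall s₀ hs₀⟩

end Summit.QuantumFields.YangMills.Theorems
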